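import Summits.QuantumFields.BalabanUV.Beta.GAN24.CombWilsonSector
import Summits.QuantumFields.BalabanUV.Beta.GAN24.StencilSlotOfShapes

/-!
# The S-slot rows `(hS0, hSall)` of the comb-chart S-tower `ScombOf` FROM its two sectors' letters — the (III′) sockets of sectors

NOT IN PRINT — OUR BOOKKEEPING (road-P2 = `b2b-balaban-gan24-p2` gen 56, 2026-08-25; row G-an2-4 ∕ (CONV-C), the (α-0) chain at row D1's literal
OF RECORD (III′) `JsB12CombShSym`; [folklore] composition BY NAME; 0 `def`, 0 cite, 0 `def … : Prop`, 0 `sorry`).  Weight 0.  NEVER «G-an2-4 closed» as (CONV-C);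
NOT D1, NOT BetaPertH, NOT continuum, NOT Clay; NO campaign opened (an2 W-4).

These are the (III′) twins of the OWNER gan24-p1's (E) sockets `GAN24/SrecAtRowOfSectors` (g19) and `GAN24/SrecAtRateOfSectors` (g22) for the comb-chart slot family
`CombChartStepJets.ScombOf tabs cE cVH cΛ` split by M.50 `CombWilsonSector.ScombOf_eq_combWilsonAt_add_combBornOf` into its cubic-Wilson lineage `combWilsonAt Lc cE` and
its born remainder `combBornOf Lc tabs cE cVH cΛ` (any `tabs : SymTables d Lc`, generic `d`, any coefficients; NO root quantifier — the comb chart's root is the centred one).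
* `exists_hS0_ScombOf_of_sectors` — uniform-in-`j` local-stencil letters for the unit tables of the two sectors (each ONE constant, ONE rate for all levels) give the same for
  `ScombOf` (constant `Cw + Cb`, rate `min δw δb`); `locStencil_unitS_ScombOf_of_sectors` — the per-level form with the constants displayed.
* `exists_hSall_ScombOf_of_sectors` — all-scales Cauchy letters (`cW·θW^k` at `δW`, `cB·θB^k` at `δB`) give the same for `ScombOf` (constant `cW + cB`, ratio `max θW θB`,
  rate `min δW δB`); `exists_hS_hSall_ScombOf_of_sectors(_common)` — the pair (v1.1: also at ONE common radius, the consumers' binder shape; gan24-leaf-05 g87 X-CSRS DOCFIX-1).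
By `StencilSlotOfShapes.unitS_add` + lit `locStencil_add` at the common rate.  Discharges NOTHING by itself (all four sector letters are HYPOTHESES): the Wilson letters are
M.52 `CombWilsonSectorRow` (⟸ a (III′) contact END) and its rate twin; the born letters are the (III′) born campaign over M.51 `CombBornSector` (nobody; not asked).
When all four land, the S-slot binders `(hS, hSall)` of the OWNER's T1 `CombTowerEndOfSlots.exists_allScalesSeq_JsB12CombShSym_of_kRows_slots` for `ScombOf` are two `exact`s.
-/

noncomputable section

open Literature.MathematicalPhysics.QuantumFieldTheory.Balaban1983to89.Beta
open OneStepResolventKernel (LocStencil)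
open StepJetData (locStencil_add)
open Summit.QuantumFields.BalabanUV.Beta.HessKerDressedUnits (unitS)
open Summit.QuantumFields.BalabanUV.Beta.GAN24.CombesThomas (sfStep smStep)
open Summit.QuantumFields.BalabanUV.Beta.SymmetrisedStepJets (SymTables)
open Summit.QuantumFields.BalabanUV.Beta.CombChartStepJets (ScombOf)
open Summit.QuantumFields.BalabanUV.Beta.GAN24.CombWilsonSector (combWilsonAt combBornOf ScombOf_eq_combWilsonAt_add_combBornOf)
open Summit.QuantumFields.BalabanUV.Beta.GAN24.StencilSlotOfShapes (unitS_add locStencil_mono')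

namespace Summit.QuantumFields.BalabanUV.Beta.GAN24.CombSRowsOfSectors

variable {d Lc : ℕ} [NeZero Lc] (tabs : SymTables d Lc) (cE cVH cΛ : ℝ)

/-- [folklore] The unit tables of `ScombOf` split along M.50's sector split (`unitS_add`). -/
theorem unitS_ScombOf_eq_add (n : ℕ) :
    unitS (sfStep Lc n) (smStep d Lc n) (ScombOf tabs cE cVH cΛ n) = fun κ u =>
      unitS (sfStep Lc n) (smStep d Lc n) (combWilsonAt (d := d) Lc cE n) κ u
        + unitS (sfStep Lc n) (smStep d Lc n) (combBornOf Lc tabs cE cVH cΛ n) κ u := by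
  rw [ScombOf_eq_combWilsonAt_add_combBornOf tabs cE cVH cΛ n]
  exact unitS_add _ _ _ _

/-! ## §1 hS0 from the two sectors -/

/-- NOT IN PRINT; OUR BOOKKEEPING ([folklore]; the (III′) twin of the OWNER's (E) `SrecAtRowOfSectors.locStencil_unitS_SrecAt_of_sectors`).  **hS0 FOR THE COMB-CHART S-TOWER
FROM ITS TWO SECTORS, PER LEVEL, CONSTANTS DISPLAYED**: local-stencil letters for the unit tables of the Wilson lineage (`Cw, δw`) and of the born remainder (`Cb, δb`) at every
level give `LocStencil (unitS_j (ScombOf … j)) (Cw + Cb) (min δw δb)`. -/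
theorem locStencil_unitS_ScombOf_of_sectors {Cw δw Cb δb : ℝ}
    (hW : ∀ j : ℕ, LocStencil (unitS (sfStep Lc j) (smStep d Lc j) (combWilsonAt (d := d) Lc cE j)) Cw δw)
    (hB : ∀ j : ℕ, LocStencil (unitS (sfStep Lc j) (smStep d Lc j) (combBornOf Lc tabs cE cVH cΛ j)) Cb δb) (j : ℕ) :
    LocStencil (unitS (sfStep Lc j) (smStep d Lc j) (ScombOf tabs cE cVH cΛ j)) (Cw + Cb) (min δw δb) := by
  rw [unitS_ScombOf_eq_add]
  exact locStencil_add (locStencil_mono' (hW j) le_rfl (min_le_left _ _)) (locStencil_mono' (hB j) le_rfl (min_le_right _ _))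

/-- NOT IN PRINT; OUR BOOKKEEPING ([folklore]; the (III′) twin of the OWNER's (E) `SrecAtRowOfSectors.exists_hS0_SrecAt_of_sectors`).  **hS0 FOR THE COMB-CHART S-TOWER
`ScombOf` FROM ITS TWO SECTORS** (generic `d`, any sym record, any coefficients): uniform-in-`j` local-stencil letters for the unit tables of the Wilson lineage `combWilsonAt`
and of the remainder `combBornOf` (each ONE constant and ONE rate for all levels) give the same for `ScombOf` — constant `Cw + Cb`, rate `min δw δb`. -/
theorem exists_hS0_ScombOf_of_sectors
    (hW : ∃ Cw δw : ℝ, 0 < δw ∧ ∀ j : ℕ, LocStencil (unitS (sfStep Lc j) (smStep d Lc j) (combWilsonAt (d := d) Lc cE j)) Cw δw)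
    (hB : ∃ Cb δb : ℝ, 0 < δb ∧ ∀ j : ℕ, LocStencil (unitS (sfStep Lc j) (smStep d Lc j) (combBornOf Lc tabs cE cVH cΛ j)) Cb δb) :
    ∃ Cs δS : ℝ, 0 < δS ∧ ∀ j : ℕ, LocStencil (unitS (sfStep Lc j) (smStep d Lc j) (ScombOf tabs cE cVH cΛ j)) Cs δS := by
  obtain ⟨Cw, δw, hδw, hW⟩ := hW
  obtain ⟨Cb, δb, hδb, hB⟩ := hB
  exact ⟨Cw + Cb, min δw δb, lt_min hδw hδb, locStencil_unitS_ScombOf_of_sectors tabs cE cVH cΛ hW hB⟩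

/-! ## §2 hSall from the two sectors -/

/-- NOT IN PRINT; OUR BOOKKEEPING ([folklore]; the (III′) twin of the OWNER's (E) `SrecAtRateOfSectors.exists_hSall_SrecAt_of_sectors`).  **(hSall) FOR THE COMB-CHART
S-TOWER `ScombOf` FROM ITS TWO SECTORS' RATE LETTERS** (generic `d`, any sym record, any coefficients): all-scales Cauchy letters for the unit tables of the Wilson lineage
(`cW·θW^k` at rate `δW`) and of the remainder (`cB·θB^k` at `δB`) give the same for `ScombOf` — constant `cW + cB`, ratio `max θW θB`, rate `min δW δB`. -/
theorem exists_hSall_ScombOf_of_sectors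
    (hW : ∃ cW θW δW : ℝ, 0 ≤ cW ∧ 0 ≤ θW ∧ θW < 1 ∧ 0 < δW ∧ ∀ k j : ℕ,
      LocStencil (unitS (sfStep Lc (k + j)) (smStep d Lc (k + j)) (combWilsonAt (d := d) Lc cE (k + j))
        - unitS (sfStep Lc k) (smStep d Lc k) (combWilsonAt (d := d) Lc cE k)) (cW * θW ^ k) δW)
    (hB : ∃ cB θB δB : ℝ, 0 ≤ cB ∧ 0 ≤ θB ∧ θB < 1 ∧ 0 < δB ∧ ∀ k j : ℕ,
      LocStencil (unitS (sfStep Lc (k + j)) (smStep d Lc (k + j)) (combBornOf Lc tabs cE cVH cΛ (k + j))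
        - unitS (sfStep Lc k) (smStep d Lc k) (combBornOf Lc tabs cE cVH cΛ k)) (cB * θB ^ k) δB) :
    ∃ cS θS δS : ℝ, 0 ≤ cS ∧ 0 ≤ θS ∧ θS < 1 ∧ 0 < δS ∧ ∀ k j : ℕ,
      LocStencil (unitS (sfStep Lc (k + j)) (smStep d Lc (k + j)) (ScombOf tabs cE cVH cΛ (k + j))
        - unitS (sfStep Lc k) (smStep d Lc k) (ScombOf tabs cE cVH cΛ k)) (cS * θS ^ k) δS := by
  obtain ⟨cW, θW, δW, hcW, hθW0, hθW1, hδW, hW⟩ := hW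
  obtain ⟨cB, θB, δB, hcB, hθB0, hθB1, hδB, hB⟩ := hB
  set θ : ℝ := max θW θB with hθ
  have hθ0 : 0 ≤ θ := le_max_of_le_left hθW0
  have hθ1 : θ < 1 := max_lt hθW1 hθB1
  refine ⟨cW + cB, θ, min δW δB, by positivity, hθ0, hθ1, lt_min hδW hδB, fun k j => ?_⟩
  have e2 : unitS (sfStep Lc (k + j)) (smStep d Lc (k + j)) (ScombOf tabs cE cVH cΛ (k + j))
        - unitS (sfStep Lc k) (smStep d Lc k) (ScombOf tabs cE cVH cΛ k)
      = fun κ u => (unitS (sfStep Lc (k + j)) (smStep d Lc (k + j)) (combWilsonAt (d := d) Lc cE (k + j))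
          - unitS (sfStep Lc k) (smStep d Lc k) (combWilsonAt (d := d) Lc cE k)) κ u
        + (unitS (sfStep Lc (k + j)) (smStep d Lc (k + j)) (combBornOf Lc tabs cE cVH cΛ (k + j))
          - unitS (sfStep Lc k) (smStep d Lc k) (combBornOf Lc tabs cE cVH cΛ k)) κ u := by
    rw [unitS_ScombOf_eq_add tabs cE cVH cΛ (k + j), unitS_ScombOf_eq_add tabs cE cVH cΛ k]
    funext κ u x y a b
    simp only [Pi.sub_apply, Pi.add_apply]
    ring
  rw [e2, add_mul]
  refine locStencil_add ?_ ?_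
  · exact locStencil_mono' (hW k j) (mul_le_mul_of_nonneg_left (pow_le_pow_left₀ hθW0 (le_max_left _ _) k) hcW) (min_le_left _ _)
  · exact locStencil_mono' (hB k j) (mul_le_mul_of_nonneg_left (pow_le_pow_left₀ hθB0 (le_max_right _ _) k) hcB) (min_le_right _ _)

/-! ## §3 Both rows at once -/

/-- NOT IN PRINT; OUR BOOKKEEPING ([folklore]).  **THE S-SLOT PAIR `(hS, hSall)` OF THE COMB-CHART S-TOWER FROM THE FOUR SECTOR LETTERS** — the conjunction of §1 and §2 in
the binder shape of the OWNER's T1 `CombTowerEndOfSlots.exists_allScalesSeq_JsB12CombShSym_of_kRows_slots` (`hS`: ∃ Cs δS, …; `hSall`: ∃ cS θS δS, …). -/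
theorem exists_hS_hSall_ScombOf_of_sectors
    (hW : ∃ Cw δw : ℝ, 0 < δw ∧ ∀ j : ℕ, LocStencil (unitS (sfStep Lc j) (smStep d Lc j) (combWilsonAt (d := d) Lc cE j)) Cw δw)
    (hB : ∃ Cb δb : ℝ, 0 < δb ∧ ∀ j : ℕ, LocStencil (unitS (sfStep Lc j) (smStep d Lc j) (combBornOf Lc tabs cE cVH cΛ j)) Cb δb)
    (hWd : ∃ cW θW δW : ℝ, 0 ≤ cW ∧ 0 ≤ θW ∧ θW < 1 ∧ 0 < δW ∧ ∀ k j : ℕ,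
      LocStencil (unitS (sfStep Lc (k + j)) (smStep d Lc (k + j)) (combWilsonAt (d := d) Lc cE (k + j))
        - unitS (sfStep Lc k) (smStep d Lc k) (combWilsonAt (d := d) Lc cE k)) (cW * θW ^ k) δW)
    (hBd : ∃ cB θB δB : ℝ, 0 ≤ cB ∧ 0 ≤ θB ∧ θB < 1 ∧ 0 < δB ∧ ∀ k j : ℕ,
      LocStencil (unitS (sfStep Lc (k + j)) (smStep d Lc (k + j)) (combBornOf Lc tabs cE cVH cΛ (k + j))
        - unitS (sfStep Lc k) (smStep d Lc k) (combBornOf Lc tabs cE cVH cΛ k)) (cB * θB ^ k) δB) :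
    (∃ Cs δS : ℝ, 0 < δS ∧ ∀ j : ℕ, LocStencil (unitS (sfStep Lc j) (smStep d Lc j) (ScombOf tabs cE cVH cΛ j)) Cs δS) ∧
    (∃ cS θS δS : ℝ, 0 ≤ cS ∧ 0 ≤ θS ∧ θS < 1 ∧ 0 < δS ∧ ∀ k j : ℕ,
      LocStencil (unitS (sfStep Lc (k + j)) (smStep d Lc (k + j)) (ScombOf tabs cE cVH cΛ (k + j))
        - unitS (sfStep Lc k) (smStep d Lc k) (ScombOf tabs cE cVH cΛ k)) (cS * θS ^ k) δS) :=
  ⟨exists_hS0_ScombOf_of_sectors tabs cE cVH cΛ hW hB, exists_hSall_ScombOf_of_sectors tabs cE cVH cΛ hWd hBd⟩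

/-- NOT IN PRINT; OUR BOOKKEEPING ([folklore]; gan24-leaf-05 g87's X-CSRS DOCFIX-1, interface fit).  **THE SAME PAIR AT ONE COMMON RATE** — the OWNER's T1
`CombTowerEndOfSlots.exists_allScalesSeq_JsB12CombShSym_of_kRows_slots` (and leaf-02's K-discharged `CombTowerEndOfSlotsK`) take ONE radius `δS` for BOTH `hS` and `hSall`
together with the sign data `0 ≤ θS < 1`, `0 < δS`: here both rows of §3 are brought to the common radius `min` by `locStencil_mono'` — so the plug is `obtain` + `exact`s. -/
theorem exists_hS_hSall_ScombOf_of_sectors_common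
    (hW : ∃ Cw δw : ℝ, 0 < δw ∧ ∀ j : ℕ, LocStencil (unitS (sfStep Lc j) (smStep d Lc j) (combWilsonAt (d := d) Lc cE j)) Cw δw)
    (hB : ∃ Cb δb : ℝ, 0 < δb ∧ ∀ j : ℕ, LocStencil (unitS (sfStep Lc j) (smStep d Lc j) (combBornOf Lc tabs cE cVH cΛ j)) Cb δb)
    (hWd : ∃ cW θW δW : ℝ, 0 ≤ cW ∧ 0 ≤ θW ∧ θW < 1 ∧ 0 < δW ∧ ∀ k j : ℕ,
      LocStencil (unitS (sfStep Lc (k + j)) (smStep d Lc (k + j)) (combWilsonAt (d := d) Lc cE (k + j))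
        - unitS (sfStep Lc k) (smStep d Lc k) (combWilsonAt (d := d) Lc cE k)) (cW * θW ^ k) δW)
    (hBd : ∃ cB θB δB : ℝ, 0 ≤ cB ∧ 0 ≤ θB ∧ θB < 1 ∧ 0 < δB ∧ ∀ k j : ℕ,
      LocStencil (unitS (sfStep Lc (k + j)) (smStep d Lc (k + j)) (combBornOf Lc tabs cE cVH cΛ (k + j))
        - unitS (sfStep Lc k) (smStep d Lc k) (combBornOf Lc tabs cE cVH cΛ k)) (cB * θB ^ k) δB) :
    ∃ Cs cS θS δS : ℝ, 0 ≤ cS ∧ 0 ≤ θS ∧ θS < 1 ∧ 0 < δS ∧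
      (∀ j : ℕ, LocStencil (unitS (sfStep Lc j) (smStep d Lc j) (ScombOf tabs cE cVH cΛ j)) Cs δS) ∧
      (∀ k j : ℕ, LocStencil (unitS (sfStep Lc (k + j)) (smStep d Lc (k + j)) (ScombOf tabs cE cVH cΛ (k + j))
        - unitS (sfStep Lc k) (smStep d Lc k) (ScombOf tabs cE cVH cΛ k)) (cS * θS ^ k) δS) := by
  obtain ⟨Cs, δ₁, hδ₁, h₁⟩ := exists_hS0_ScombOf_of_sectors tabs cE cVH cΛ hW hB
  obtain ⟨cS, θS, δ₂, hcS, hθ0, hθ1, hδ₂, h₂⟩ := exists_hSall_ScombOf_of_sectors tabs cE cVH cΛ hWd hBd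
  exact ⟨Cs, cS, θS, min δ₁ δ₂, hcS, hθ0, hθ1, lt_min hδ₁ hδ₂, fun j => locStencil_mono' (h₁ j) le_rfl (min_le_left _ _),
    fun k j => locStencil_mono' (h₂ k j) le_rfl (min_le_right _ _)⟩

end Summit.QuantumFields.BalabanUV.Beta.GAN24.CombSRowsOfSectors

end
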